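import Literature.NumberTheory.LFunctions.WeilExplicitDirichlet
import HarnessLib

/-!
# rh-explicit (venture WeilGRH): parity bookkeeping — `charParity χ = 0 / 1` as the value `χ(−1) = 1 / −1` (weil-3 gen20)

Cell `rh-explicit`, WEIL TRACK (structure seat weil-3, gen20).  Two one-line conversions used by every assembly file of the «highest lowest zero»
ladder (`Third*`, `Quad*`): the tree's `charParity` (`0` for even, `1` for odd characters) back to the value at `−1`.  Stated ONCE here so the
assembly files cite them (the textual-duplicate lint).  RH/GRH-free; no definitions; standard axioms.
-/

set_option autoImplicit false

namespace Summit.Ventures.WeilGRH.Christoffel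

open Literature.NumberTheory.LFunctions

/-- `charParity χ = 0` means `χ(−1) = 1`. -/
theorem chi_neg_one_eq_one_of_charParity_eq_zero {q : ℕ} [NeZero q] (χ : DirichletCharacter ℂ q) (hk : charParity χ = 0) :
    χ (-1) = 1 := by
  rcases χ.even_or_odd with he | ho
  · exact he
  · rw [charParity_of_odd ho] at hk; exact absurd hk one_ne_zero

/-- `charParity χ = 1` means `χ(−1) = −1`. -/
theorem chi_neg_one_eq_neg_one_of_charParity_eq_one {q : ℕ} [NeZero q] (χ : DirichletCharacter ℂ q) (hk : charParity χ = 1) :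
    χ (-1) = -1 := by
  rcases χ.even_or_odd with he | ho
  · rw [charParity_of_even he] at hk; exact absurd hk zero_ne_one
  · exact ho

end Summit.Ventures.WeilGRH.Christoffel
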